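import Summits.CriticalPhenomena.Ising3DConformalLimit.Theses.MirrorHoelderCompactness
import Summits.CriticalPhenomena.Ising3DConformalLimit.Theorems.HyperoctahedralRPExistsScaleCovariantLimitBlockCovTwoPointBounds
import HarnessLib

/-!
# Ball sums of the critical two-point function against the block variance
(stub `stub_ballSumRatio` (E1), line `Sketch`, crux `JoiningsTransfer`, item stmt-CriticalPhenomena-18764,
route `SynchronousCoupling`, sub-problem `CriticalPhenomena/Ising3DConformalLimit`)

With `G = ⟨σ₀σ_z⟩_{β_c} ≥ 0` the critical two-point function of the n.n. Ising model on `ℤ³`,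
`g(m) = G(m e₀)` its (antitone, positive) axial values, `S(R) = Σ_{‖z‖_∞ ≤ R} G(z)` the ball sums and
`V(L) = blockCov L 0 = Σ_{x,y ∈ cube L} G(y - x)` the block variance, we prove: for every `c : ℕ` there are
`A` and `L₀ ≥ 1` with `L³ S(cL) ≤ A V(L)` for all `L ≥ L₀` (here `A = 8 (1 + 373248 (c+1)³)`, `L₀ = 8`).

Ingredients (all from the Messager–Miracle-Solé sphere sandwich `g(3‖z‖_∞) ≤ G(z) ≤ g(‖z‖_∞)`,
`criticalTwoPoint_axis_sandwich`, and axis antitonicity `criticalTwoPoint_axis_antitone`):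
* LOWER BOUND `M³ g(M) ≤ 27 S(M)`: every `z` with `‖z‖_∞ ≤ ⌊M/3⌋` has `G(z) ≥ g(M)`, and there are
  `(2⌊M/3⌋+1)³ ≥ (M/3)³` of them;
* SHELL BOUND `S(R) ≤ S(r) + (2R+1)³ g(r)` for `1 ≤ r ≤ R`: outside `Λ_r`, `G(z) ≤ g(‖z‖_∞) ≤ g(r)`;
* INNER CUBE `(L - 2q)³ S(q) ≤ V(L)` for `2q ≤ L`: the rows `Σ_{y ∈ cube L} G(y - x)` with `x` at
  `ℓ^∞`-distance `≥ q` from the complement of the cube each dominate `S(q)`.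
With `q = ⌊L/4⌋`, `r = q`, `R = (c+1)L` these give `L³ S(cL) ≤ (1 + 27·512·27 (c+1)³) L³ S(q) ≤ A V(L)`.
The hypothesis `TwoPointDoubling` of the registered signature is not used.

Sources: A. Messager, S. Miracle-Solé, J. Stat. Phys. 17 (1977) 245 (monotonicity under reflections);
H. Duminil-Copin, *Lectures on the Ising and Potts models on the hypercubic lattice* (2019) §4.3, eq. (4.10).
Templates adapted from `Theorems/HyperoctahedralRPExistsScaleCovariantLimitBlockCovTwoPointBounds.lean`
(`le_axis_of_le_supNorm`, `boxSum_mono`, `shell`, `blockCov_le_boxSum`). [folklore]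
-/

noncomputable section

namespace Summit.CriticalPhenomena.Ising3DConformalLimit.Cruxes.JoiningsTransfer.Sketch

open Literature.Probability.LatticeModels Filter Set
open scoped Topology BigOperators
open Summit.CriticalPhenomena.Ising3DConformalLimit.Theses
open Summit.CriticalPhenomena.Ising3DConformalLimit.Cruxes.ExistsScaleCovariantLimit.MonotoneBlockingPort

/-! ## Pointwise comparison with the axis -/

-- adapted from `le_axis_of_le_supNorm` in
-- `Theorems/HyperoctahedralRPExistsScaleCovariantLimitBlockCovTwoPointBounds.lean`
/-- `⟨σ₀σ_z⟩_{β_c} ≤ g(N)` whenever `1 ≤ ‖z‖_∞` and `N ≤ ‖z‖_∞` (MMS sphere bound and axis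
antitonicity). [folklore] -/
private theorem stub_ballSumRatio_le_axis {z : Site 3} {N : ℕ} (h1 : 1 ≤ Site.supNorm z)
    (hN : N ≤ Site.supNorm z) :
    criticalTwoPoint 3 z ≤ criticalTwoPoint 3 (Pi.single 0 (N : ℤ)) :=
  (criticalTwoPoint_axis_sandwich h1).2.trans (criticalTwoPoint_axis_antitone hN)

/-- `g(N) ≤ ⟨σ₀σ_z⟩_{β_c}` whenever `3 ‖z‖_∞ ≤ N` (lower half of the MMS sphere sandwich and axis
antitonicity; at `z = 0` it is `g(N) ≤ 1 = ⟨σ₀σ₀⟩`). [folklore] -/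
private theorem stub_ballSumRatio_axis_le {z : Site 3} {N : ℕ} (hN : 3 * Site.supNorm z ≤ N) :
    criticalTwoPoint 3 (Pi.single 0 (N : ℤ)) ≤ criticalTwoPoint 3 z := by
  rcases Nat.eq_zero_or_pos (Site.supNorm z) with h0 | hpos
  · rw [Site.supNorm_eq_zero_iff.1 h0, criticalTwoPoint_zero']
    exact criticalTwoPoint_le_one' _
  · exact (criticalTwoPoint_axis_antitone hN).trans (criticalTwoPoint_axis_sandwich hpos).1

/-! ## Ball sums `S(R) = Σ_{‖z‖_∞ ≤ R} ⟨σ₀σ_z⟩_{β_c}` -/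

-- adapted from `boxSum_mono` in
-- `Theorems/HyperoctahedralRPExistsScaleCovariantLimitBlockCovTwoPointBounds.lean`
/-- `S(R)` is monotone in `R` (Griffiths: the terms are `≥ 0`). [folklore] -/
private theorem stub_ballSumRatio_boxSum_mono {R R' : ℕ} (h : R ≤ R') :
    ∑ z ∈ box 3 R, criticalTwoPoint 3 z ≤ ∑ z ∈ box 3 R', criticalTwoPoint 3 z :=
  Finset.sum_le_sum_of_subset_of_nonneg (box_mono 3 h) fun z _ _ => criticalTwoPoint_nonneg' z

/-- LOWER BOUND: `M³ g(M) ≤ 27 S(M)` (the `(2⌊M/3⌋+1)³ ≥ (M/3)³` sites of `Λ_{⌊M/3⌋}` each carry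
`⟨σ₀σ_z⟩ ≥ g(M)`). [folklore] -/
private theorem stub_ballSumRatio_cube_mul_axis_le_boxSum (M : ℕ) :
    (M : ℝ) ^ 3 * criticalTwoPoint 3 (Pi.single 0 (M : ℤ)) ≤
      27 * ∑ z ∈ box 3 M, criticalTwoPoint 3 z := by
  have hg := (criticalTwoPoint_axis_pos M).le
  have hpt : ∀ z ∈ box 3 (M / 3),
      criticalTwoPoint 3 (Pi.single 0 (M : ℤ)) ≤ criticalTwoPoint 3 z := by
    intro z hz
    rw [mem_box_iff_supNorm_le] at hz
    exact stub_ballSumRatio_axis_le (by omega)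
  have hcard : ((M : ℝ) / 3) ^ 3 ≤ ((box 3 (M / 3)).card : ℝ) := by
    rw [card_box, Nat.cast_pow]
    refine pow_le_pow_left₀ (by positivity) ?_ 3
    rw [div_le_iff₀ (by norm_num : (0 : ℝ) < 3)]
    have h : M ≤ (2 * (M / 3) + 1) * 3 := by omega
    exact_mod_cast h
  calc (M : ℝ) ^ 3 * criticalTwoPoint 3 (Pi.single 0 (M : ℤ))
      = 27 * (((M : ℝ) / 3) ^ 3 * criticalTwoPoint 3 (Pi.single 0 (M : ℤ))) := by ring
    _ ≤ 27 * (((box 3 (M / 3)).card : ℝ) * criticalTwoPoint 3 (Pi.single 0 (M : ℤ))) :=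
        mul_le_mul_of_nonneg_left (mul_le_mul_of_nonneg_right hcard hg) (by norm_num)
    _ = 27 * ∑ _z ∈ box 3 (M / 3), criticalTwoPoint 3 (Pi.single 0 (M : ℤ)) := by
        rw [Finset.sum_const, nsmul_eq_mul]
    _ ≤ 27 * ∑ z ∈ box 3 (M / 3), criticalTwoPoint 3 z :=
        mul_le_mul_of_nonneg_left (Finset.sum_le_sum hpt) (by norm_num)
    _ ≤ 27 * ∑ z ∈ box 3 M, criticalTwoPoint 3 z :=
        mul_le_mul_of_nonneg_left (stub_ballSumRatio_boxSum_mono (Nat.div_le_self M 3)) (by norm_num)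

-- adapted from `shell` in `Theorems/HyperoctahedralRPExistsScaleCovariantLimitBlockCovTwoPointBounds.lean`
/-- SHELL BOUND: `S(R) ≤ S(r) + (2R+1)³ g(r)` for `1 ≤ r ≤ R` (every `z ∈ Λ_R ∖ Λ_r` has
`⟨σ₀σ_z⟩ ≤ g(‖z‖_∞) ≤ g(r)`, and `|Λ_R| = (2R+1)³`). [folklore] -/
private theorem stub_ballSumRatio_shell {r R : ℕ} (hr : 1 ≤ r) (hrR : r ≤ R) :
    ∑ z ∈ box 3 R, criticalTwoPoint 3 z ≤
      ∑ z ∈ box 3 r, criticalTwoPoint 3 z +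
        (2 * (R : ℝ) + 1) ^ 3 * criticalTwoPoint 3 (Pi.single 0 (r : ℤ)) := by
  have hsub : box 3 r ⊆ box 3 R := box_mono 3 hrR
  have hg := (criticalTwoPoint_axis_pos r).le
  have hdiff : ∑ z ∈ box 3 R \ box 3 r, criticalTwoPoint 3 z ≤
      (2 * (R : ℝ) + 1) ^ 3 * criticalTwoPoint 3 (Pi.single 0 (r : ℤ)) := by
    calc ∑ z ∈ box 3 R \ box 3 r, criticalTwoPoint 3 z
        ≤ ∑ _z ∈ box 3 R \ box 3 r, criticalTwoPoint 3 (Pi.single 0 (r : ℤ)) :=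
          Finset.sum_le_sum fun z hz => by
            rw [Finset.mem_sdiff, mem_box_iff_supNorm_le, mem_box_iff_supNorm_le] at hz
            exact stub_ballSumRatio_le_axis (by omega) (by omega)
      _ = ((box 3 R \ box 3 r).card : ℝ) * criticalTwoPoint 3 (Pi.single 0 (r : ℤ)) := by
          rw [Finset.sum_const, nsmul_eq_mul]
      _ ≤ ((box 3 R).card : ℝ) * criticalTwoPoint 3 (Pi.single 0 (r : ℤ)) := by
          gcongr
          exact Finset.sdiff_subset
      _ = (2 * (R : ℝ) + 1) ^ 3 * criticalTwoPoint 3 (Pi.single 0 (r : ℤ)) := by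
          rw [card_box]
          push_cast
          ring
  rw [← Finset.sum_sdiff hsub]
  linarith

/-! ## The inner cube: `(L - 2q)³ S(q) ≤ V(L)` -/

-- adapted from `blockCov_le_boxSum` in
-- `Theorems/HyperoctahedralRPExistsScaleCovariantLimitBlockCovTwoPointBounds.lean`
/-- INNER CUBE: for `2q ≤ L`, `(L - 2q)³ S(q) ≤ V(L)`: for each of the `(L-2q)³` sites `x` of the inner
cube `[q, L-q)³`, the translate `x + Λ_q` lies in `cube L`, so the row `Σ_{y ∈ cube L} ⟨σ_xσ_y⟩`
dominates `S(q)` (Griffiths: all terms are `≥ 0`). [folklore] -/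
private theorem stub_ballSumRatio_innerCube {q L : ℕ} (hqL : 2 * q ≤ L) :
    ((L : ℝ) - 2 * q) ^ 3 * ∑ z ∈ box 3 q, criticalTwoPoint 3 z ≤ blockCov L 0 := by
  rw [blockCov_zero_eq]
  obtain ⟨I, hI⟩ : ∃ I : Finset (Site 3),
      I = Fintype.piFinset fun _ : Fin 3 => Finset.Ico (q : ℤ) ((L : ℤ) - q) := ⟨_, rfl⟩
  have hIsub : I ⊆ cube L := by
    intro x hx
    rw [hI, Fintype.mem_piFinset] at hx
    rw [mem_cube]
    intro i
    have h := hx i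
    rw [Finset.mem_Ico] at h
    constructor <;> omega
  have hIcard : (I.card : ℝ) = ((L : ℝ) - 2 * q) ^ 3 := by
    have h0 : (0 : ℤ) ≤ (L : ℤ) - q - q := by omega
    have h1 : ((((L : ℤ) - q - q).toNat : ℕ) : ℤ) = (L : ℤ) - q - q := Int.toNat_of_nonneg h0
    have h2 : (((((L : ℤ) - q - q).toNat : ℕ) : ℤ) : ℝ) = (((L : ℤ) - q - q : ℤ) : ℝ) := by rw [h1]
    push_cast at h2
    rw [hI, Fintype.card_piFinset_const, Int.card_Ico, Nat.cast_pow]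
    congr 1
    linarith
  have hrow : ∀ x ∈ I,
      ∑ z ∈ box 3 q, criticalTwoPoint 3 z ≤ ∑ y ∈ cube L, criticalTwoPoint 3 (y - x) := by
    intro x hx
    rw [hI, Fintype.mem_piFinset] at hx
    have himg : (box 3 q).image (fun z => x + z) ⊆ cube L := by
      intro y hy
      rw [Finset.mem_image] at hy
      obtain ⟨z, hz, rfl⟩ := hy
      rw [mem_box] at hz
      rw [mem_cube]
      intro i
      have h1 := hx i
      rw [Finset.mem_Ico] at h1
      obtain ⟨h3, h4⟩ := hz i
      simp only [Pi.add_apply]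
      constructor <;> omega
    calc ∑ z ∈ box 3 q, criticalTwoPoint 3 z
        = ∑ z ∈ box 3 q, criticalTwoPoint 3 (x + z - x) :=
          Finset.sum_congr rfl fun z _ => by rw [add_sub_cancel_left]
      _ = ∑ y ∈ (box 3 q).image (fun z => x + z), criticalTwoPoint 3 (y - x) :=
          (Finset.sum_image (f := fun y => criticalTwoPoint 3 (y - x))
            fun a _ b _ h => add_left_cancel h).symm
      _ ≤ ∑ y ∈ cube L, criticalTwoPoint 3 (y - x) :=
          Finset.sum_le_sum_of_subset_of_nonneg himg fun y _ _ => criticalTwoPoint_nonneg' _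
  calc ((L : ℝ) - 2 * q) ^ 3 * ∑ z ∈ box 3 q, criticalTwoPoint 3 z
      = ∑ _x ∈ I, ∑ z ∈ box 3 q, criticalTwoPoint 3 z := by
        rw [Finset.sum_const, nsmul_eq_mul, hIcard]
    _ ≤ ∑ x ∈ I, ∑ y ∈ cube L, criticalTwoPoint 3 (y - x) := Finset.sum_le_sum hrow
    _ ≤ ∑ x ∈ cube L, ∑ y ∈ cube L, criticalTwoPoint 3 (y - x) :=
        Finset.sum_le_sum_of_subset_of_nonneg hIsub fun x _ _ =>
          Finset.sum_nonneg fun y _ => criticalTwoPoint_nonneg' _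

/-! ## The stub -/

/-- **Stub E1 — ball sums against the block variance.** For every `c : ℕ` there are `A` and `L₀ ≥ 1`
with `L³ S(cL) ≤ A V(L)` for all `L ≥ L₀`, where `S(R) = Σ_{z ∈ Λ_R} ⟨σ₀σ_z⟩_{β_c}` and
`V(L) = blockCov L 0`. Proof: with `q = ⌊L/4⌋ ≥ 1` (`L ≥ 8`), the shell bound at `r = q`,
`R = (c+1)L` and the lower bound `q³ g(q) ≤ 27 S(q)` give `S(cL) ≤ S(R) ≤ (1 + 373248 (c+1)³) S(q)`
(`(2R+1)³ ≤ 27 (c+1)³ L³`, `L³ ≤ 512 q³`), and the inner cube gives `L³ S(q) ≤ 8 (L-2q)³ S(q) ≤ 8 V(L)`.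
The doubling hypothesis is not needed (Messager–Miracle-Solé alone). [folklore] -/
theorem stub_ballSumRatio : MirrorHoelderCompactness.TwoPointDoubling →
    ∀ c : ℕ, ∃ A : ℝ, ∃ L₀ : ℕ, 1 ≤ L₀ ∧ ∀ L : ℕ, L₀ ≤ L →
      (L : ℝ) ^ 3 * ∑ z ∈ box 3 (c * L), criticalTwoPoint 3 z ≤ A * blockCov L 0 := by
  intro _ c
  refine ⟨8 * (1 + 373248 * ((c : ℝ) + 1) ^ 3), 8, by norm_num, fun L hL => ?_⟩
  obtain ⟨q, hq⟩ : ∃ q : ℕ, q = L / 4 := ⟨_, rfl⟩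
  have hq1 : 1 ≤ q := by omega
  have h4q : 4 * q ≤ L := by omega
  have hL8q : L ≤ 8 * q := by omega
  have h2q : 2 * q ≤ L := by omega
  have hqR : q ≤ (c + 1) * L :=
    le_trans (by omega : q ≤ L) (Nat.le_mul_of_pos_left L (Nat.succ_pos c))
  have hcR : c * L ≤ (c + 1) * L := Nat.mul_le_mul_right L (Nat.le_succ c)
  -- the four lattice inputs
  have h1 := stub_ballSumRatio_boxSum_mono hcR
  have h2 := stub_ballSumRatio_shell hq1 hqR
  have h3 := stub_ballSumRatio_cube_mul_axis_le_boxSum q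
  have h4 := stub_ballSumRatio_innerCube h2q
  have hR : (((c + 1) * L : ℕ) : ℝ) = ((c : ℝ) + 1) * L := by push_cast; ring
  rw [hR] at h2
  set Sc := ∑ z ∈ box 3 (c * L), criticalTwoPoint 3 z with hSc
  set SR := ∑ z ∈ box 3 ((c + 1) * L), criticalTwoPoint 3 z with hSR
  set Sq := ∑ z ∈ box 3 q, criticalTwoPoint 3 z with hSq
  set g := criticalTwoPoint 3 (Pi.single 0 (q : ℤ)) with hg
  have hSq0 : 0 ≤ Sq := Finset.sum_nonneg fun z _ => criticalTwoPoint_nonneg' z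
  have hg0 : 0 ≤ g := (criticalTwoPoint_axis_pos q).le
  -- elementary real arithmetic
  have hL1 : (1 : ℝ) ≤ L := by exact_mod_cast (show 1 ≤ L by omega)
  have hL0 : (0 : ℝ) ≤ L := by positivity
  have hc0 : (0 : ℝ) ≤ c := Nat.cast_nonneg c
  have h4qR : 4 * (q : ℝ) ≤ L := by exact_mod_cast h4q
  have hL8qR : (L : ℝ) ≤ 8 * q := by exact_mod_cast hL8q
  have hA : (2 * (((c : ℝ) + 1) * L) + 1) ^ 3 ≤ 27 * ((c : ℝ) + 1) ^ 3 * (L : ℝ) ^ 3 := by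
    have h : 2 * (((c : ℝ) + 1) * L) + 1 ≤ 3 * (((c : ℝ) + 1) * L) := by
      nlinarith [mul_nonneg hc0 hL0]
    calc (2 * (((c : ℝ) + 1) * L) + 1) ^ 3 ≤ (3 * (((c : ℝ) + 1) * L)) ^ 3 :=
          pow_le_pow_left₀ (by positivity) h 3
      _ = 27 * ((c : ℝ) + 1) ^ 3 * (L : ℝ) ^ 3 := by ring
  have hB : (L : ℝ) ^ 3 * g ≤ 512 * (q : ℝ) ^ 3 * g := by
    refine mul_le_mul_of_nonneg_right ?_ hg0
    calc (L : ℝ) ^ 3 ≤ (8 * (q : ℝ)) ^ 3 := pow_le_pow_left₀ hL0 hL8qR 3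
      _ = 512 * (q : ℝ) ^ 3 := by ring
  have hC : (L : ℝ) ^ 3 ≤ 8 * ((L : ℝ) - 2 * q) ^ 3 := by
    calc (L : ℝ) ^ 3 ≤ (2 * ((L : ℝ) - 2 * q)) ^ 3 := pow_le_pow_left₀ hL0 (by linarith) 3
      _ = 8 * ((L : ℝ) - 2 * q) ^ 3 := by ring
  have hK0 : (0 : ℝ) ≤ 1 + 373248 * ((c : ℝ) + 1) ^ 3 := by positivity
  -- `L³ S(cL) ≤ (1 + 373248 (c+1)³) L³ S(q)`
  have hmain : (L : ℝ) ^ 3 * Sc ≤ (1 + 373248 * ((c : ℝ) + 1) ^ 3) * ((L : ℝ) ^ 3 * Sq) := by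
    calc (L : ℝ) ^ 3 * Sc ≤ (L : ℝ) ^ 3 * SR := mul_le_mul_of_nonneg_left h1 (by positivity)
      _ ≤ (L : ℝ) ^ 3 * (Sq + (2 * (((c : ℝ) + 1) * L) + 1) ^ 3 * g) :=
          mul_le_mul_of_nonneg_left h2 (by positivity)
      _ = (L : ℝ) ^ 3 * Sq + (2 * (((c : ℝ) + 1) * L) + 1) ^ 3 * ((L : ℝ) ^ 3 * g) := by ring
      _ ≤ (L : ℝ) ^ 3 * Sq + (27 * ((c : ℝ) + 1) ^ 3 * (L : ℝ) ^ 3) * (512 * (q : ℝ) ^ 3 * g) :=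
          add_le_add le_rfl (mul_le_mul hA hB (mul_nonneg (by positivity) hg0) (by positivity))
      _ = (L : ℝ) ^ 3 * Sq + 13824 * ((c : ℝ) + 1) ^ 3 * (L : ℝ) ^ 3 * ((q : ℝ) ^ 3 * g) := by
          ring
      _ ≤ (L : ℝ) ^ 3 * Sq + 13824 * ((c : ℝ) + 1) ^ 3 * (L : ℝ) ^ 3 * (27 * Sq) :=
          add_le_add le_rfl (mul_le_mul_of_nonneg_left h3 (by positivity))
      _ = (1 + 373248 * ((c : ℝ) + 1) ^ 3) * ((L : ℝ) ^ 3 * Sq) := by ring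
  calc (L : ℝ) ^ 3 * Sc ≤ (1 + 373248 * ((c : ℝ) + 1) ^ 3) * ((L : ℝ) ^ 3 * Sq) := hmain
    _ ≤ (1 + 373248 * ((c : ℝ) + 1) ^ 3) * (8 * ((L : ℝ) - 2 * q) ^ 3 * Sq) :=
        mul_le_mul_of_nonneg_left (mul_le_mul_of_nonneg_right hC hSq0) hK0
    _ = 8 * (1 + 373248 * ((c : ℝ) + 1) ^ 3) * (((L : ℝ) - 2 * q) ^ 3 * Sq) := by ring
    _ ≤ 8 * (1 + 373248 * ((c : ℝ) + 1) ^ 3) * blockCov L 0 :=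
        mul_le_mul_of_nonneg_left h4 (by positivity)

end Summit.CriticalPhenomena.Ising3DConformalLimit.Cruxes.JoiningsTransfer.Sketch

end
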